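import Literature.AlgebraicGeometry.HodgeTheory.ComplexGysin
import Literature.AlgebraicGeometry.HodgeTheory.ComplexGysinSurjective
import Literature.AlgebraicGeometry.HodgeTheory.CurveCorrespondencePushforward
import Literature.AlgebraicGeometry.HodgeTheory.GysinBaseChangeOfKunneth
import Literature.AlgebraicGeometry.HodgeTheory.HolomorphicBundleChernCharacterTopDegree
import Literature.AlgebraicGeometry.HodgeTheory.ChernCharacterBetti
import Literature.AlgebraicGeometry.HodgeTheory.AlgebraicClasses
import Literature.AlgebraicTopology.SingularHomology.CupProduct
import Literature.AlgebraicTopology.SingularHomology.CupProductProofs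
import Literature.AlgebraicTopology.SingularHomology.CompactGroupExteriorCohomology
import HarnessLib

/-!
# `HyperbolicEightfoldsSqrtMinus7`, line `euler-squeeze-rank-two-secant-bundle`: stub D — Gysin descent of
# algebraicity along the fibres of a projective-bundle-like morphism (item stmt-HodgeConjecture-14642)

Crux `HeckePrymWeil.HyperbolicEightfoldsSqrtMinus7`, skeleton v4 (lead c12, 2026-08-17), registered stub
`stub_gysinDescent` (D), proved here UNCONDITIONALLY from the tree's Gysin formalism on
`H*(–(ℂ); ℂ)` of smooth projective complex varieties.

Setting: `p : Q ⟶ Y` a surjective morphism of smooth projective complex varieties of dimensions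
`nY + m` and `nY` (in the line: a Brauer–Severi variety over an abelian fibre), `H ∈ H²(Y(ℂ))` a class
whose cup product with algebraic classes stays algebraic, `Λ ∈ H²(Q(ℂ))` with algebraic cup powers and
NON-DEGENERATE along `p` (`p^* y ∪ Λᵐ ≠ 0` for some top class `y` of `Y`). If
`Σ_{i+j=n+m} c_{ij} • p^*(Hⁱ) ∪ Λʲ + r • p^*(W) ∪ Λᵐ` (`r ≠ 0`) is algebraic on `Q`, then `W` is
algebraic on `Y`.

Proof (W. Fulton, *Young Tableaux*, App. B §B.1 (5)–(7); C. Voisin, *Hodge Theory I*, §7.3.2): fix an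
orientation family `μ` (`Motives.ComplexPoints.isOrientableOver`) and push the class forward along
`p_* = complexGysin μ` (`H^{2(n+m)}(Q(ℂ)) → H^{2n}(Y(ℂ))`), which preserves algebraic classes
(`complexGysin_mem_algebraicClasses_of_mem_algebraicClasses`). By the projection formula
(`complexGysin_cup`) and `H⁰(Y(ℂ); ℂ) = ℂ · 1` (`exists_eq_smul_one`), `p_*(Λᵐ) = t • 1` and the
`W`-term becomes `(r t) • W`; `t ≠ 0` because `p_*(p^* y ∪ Λᵐ) = t • y` while `p_*` is injective in the
top degree (onto by `complexGysin_surjective_of_surjective`, between lines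
`finrank_complexBetti_two_mul_eq_one`). The terms `p^*(Hⁱ) ∪ Λʲ` with `j < m` die under `p_*`
(`complexGysin_cup_map_eq_zero_of_lt`), and those with `j = m + e` give `Hⁱ ∪ p_*(Λʲ)` with
`p_*(Λʲ)` algebraic of codimension `e`, hence algebraic (`Hⁱ ∪ –` preserves algebraicity by iterating
the hypothesis on `H`, graded commutativity in even degrees). So `(r t) • W`, and with it `W`, is
algebraic. No `sorry`, no new definition, no named fact.

## References

* [FultonYoungTableaux1997] W. Fulton, Young Tableaux, CUP 1997, Appendix B §B.1 (3), (5)–(7).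
* [VoisinHodgeI2002] C. Voisin, Hodge Theory and Complex Algebraic Geometry I, CUP 2002, §7.3.2
  Lemma 7.28, Remark 7.29; §11.1.2.
* [HatcherAT2002] A. Hatcher, Algebraic Topology, CUP 2002, §3.2 Thm. 3.11, §3.3 Thm. 3.26, Cor. 3.37.
-/

noncomputable section

-- single-problem summit (Problem = Summit): the mandated namespace repeats `HodgeConjecture`.
set_option linter.dupNamespace false

open CategoryTheory AlgebraicGeometry Limits MonoidalCategory CartesianMonoidalCategory
open Literature.AlgebraicGeometry Literature.AlgebraicGeometry.Motives Literature.AlgebraicGeometry.HodgeTheory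
open Literature.AlgebraicTopology.SingularHomology

namespace Summit.HodgeConjecture.HodgeConjecture.Theorems.HyperbolicEightfoldsSqrtMinus7.AnchorObjectBS

variable {Y : SchemeOver ℂ} {H : complexBetti Y 2}

/-- **`β ∪ Hⁱ` is algebraic for `β` algebraic**, when `– ∪ H` preserves algebraic classes (iterate
`xⁱ⁺¹ = xⁱ ∪ x` and associativity `β ∪ (Hⁱ ∪ H) = (β ∪ Hⁱ) ∪ H`).
[cite: HatcherAT2002, §3.2 p. 211] [cite: FultonYoungTableaux1997, Appendix B §B.1 (3)] -/
private theorem cup_cupPowTwo_mem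
    (hH : ∀ (l : ℕ) (α : complexBetti Y (2 * l)), α ∈ algebraicClasses Y l →
      cupProduct (two_mul_add_two l) α H ∈ algebraicClasses Y (l + 1))
    (i : ℕ) {e k : ℕ} (hk : e + i = k) (h : 2 * e + 2 * i = 2 * k) (β : complexBetti Y (2 * e))
    (hβ : β ∈ algebraicClasses Y e) : cupProduct h β (cupPowTwo H i) ∈ algebraicClasses Y k := by
  induction i generalizing k with
  | zero =>
    obtain rfl : k = e := by omega
    have h1 : cupProduct h β (cupPowTwo H 0) = β := cupProduct_one' _ _ _
    rw [h1]
    exact hβ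
  | succ i ih =>
    obtain rfl : k = e + i + 1 := by omega
    rw [cupPowTwo_succ, ← cupProduct_assoc (show 2 * e + 2 * i = 2 * (e + i) by omega)
      (two_mul_add_two i) (two_mul_add_two (e + i)) h]
    exact hH (e + i) _ (ih rfl _)

/-- **`Hⁱ ∪ β` is algebraic for `β` algebraic**, when `– ∪ H` preserves algebraic classes: graded
commutativity `Hⁱ ∪ β = β ∪ Hⁱ` (the sign `(-1)^{2i·q}` is `1`) and `cup_cupPowTwo_mem`.
[cite: HatcherAT2002, §3.2 Thm. 3.11] -/
private theorem cupPowTwo_cup_mem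
    (hH : ∀ (l : ℕ) (α : complexBetti Y (2 * l)), α ∈ algebraicClasses Y l →
      cupProduct (two_mul_add_two l) α H ∈ algebraicClasses Y (l + 1))
    (i : ℕ) {e k : ℕ} (hk : i + e = k) (h : 2 * i + 2 * e = 2 * k) (β : complexBetti Y (2 * e))
    (hβ : β ∈ algebraicClasses Y e) : cupProduct h (cupPowTwo H i) β ∈ algebraicClasses Y k := by
  rw [cupProduct_gradedComm_holds ℂ (ComplexPoints Y) h (show 2 * e + 2 * i = 2 * k by omega)
      (cupPowTwo H i) β, Even.neg_one_pow ((even_two_mul i).mul_right _), one_smul]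
  exact cup_cupPowTwo_mem hH i (by omega) _ β hβ

/-- **Stub D of line `euler-squeeze-rank-two-secant-bundle` — Gysin descent of algebraicity along the
fibres of a projective-bundle-like morphism.** For `p : Q ⟶ Y` a surjective morphism of smooth
projective complex varieties of dimensions `nY + m`, `nY`; `H ∈ H²(Y(ℂ))` with `(algebraic) ∪ H`
algebraic and algebraic powers; `Λ ∈ H²(Q(ℂ))` with algebraic powers and `p^* y ∪ Λᵐ ≠ 0` for some
top class `y` of `Y`: if `Σ_{i+j=n+m} c_{ij} • p^*(Hⁱ) ∪ Λʲ + r • p^*(W) ∪ Λᵐ` with `r ≠ 0` is algebraic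
on `Q`, then `W` is algebraic on `Y`. Proof: push forward along `p_*` (`complexGysin`, preserves
algebraic classes) and evaluate term by term with the projection formula `p_*(p^* x ∪ y) = x ∪ p_* y`
(`complexGysin_cup`): `p_*(Λᵐ) = t • 1` with `t ≠ 0` (`p_*` is one-to-one in the top degree, being onto
between lines), the terms with `j < m` vanish (`complexGysin_cup_map_eq_zero_of_lt`), those with
`j ≥ m` are `Hⁱ ∪ (algebraic)`; so `(r t) • W` is algebraic.
[cite: FultonYoungTableaux1997, Appendix B §B.1 (5)–(7)] [cite: VoisinHodgeI2002, §7.3.2 Lemma 7.28 and Remark 7.29] -/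
theorem stub_gysinDescent :
    ∀ ⦃Q Y : SchemeOver ℂ⦄ (nY m : ℕ) (_hQ : IsSmoothProjective (nY + m) Q) (_hY : IsSmoothProjective nY Y)
      (p : Q ⟶ Y), Function.Surjective p.left.base →
      ∀ (H : complexBetti Y 2) (Λ : complexBetti Q 2),
        (∀ (l : ℕ) (α : complexBetti Y (2 * l)), α ∈ algebraicClasses Y l →
          cupProduct (two_mul_add_two l) α H ∈ algebraicClasses Y (l + 1)) →
        (∀ i : ℕ, cupPowTwo H i ∈ algebraicClasses Y i) →
        (∀ j : ℕ, cupPowTwo Λ j ∈ algebraicClasses Q j) →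
        (∃ y : complexBetti Y (2 * nY),
          cupProduct (show 2 * nY + 2 * m = 2 * (nY + m) by omega) (complexBetti.map p (2 * nY) y) (cupPowTwo Λ m) ≠ 0) →
        ∀ (n : ℕ) (W : complexBetti Y (2 * n)) (c : ℕ → ℕ → ℂ) (r : ℂ), r ≠ 0 →
          (∑ i ∈ Finset.range (n + m + 1), ∑ j ∈ Finset.range (n + m + 1),
              if hij : i + j = n + m then
                c i j • cupProduct (show 2 * i + 2 * j = 2 * (n + m) by omega)
                  (complexBetti.map p (2 * i) (cupPowTwo H i)) (cupPowTwo Λ j)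
              else 0) +
            r • cupProduct (show 2 * n + 2 * m = 2 * (n + m) by omega) (complexBetti.map p (2 * n) W) (cupPowTwo Λ m)
              ∈ algebraicClasses Q (n + m) →
          W ∈ algebraicClasses Y n := by
  intro Q Y nY m hQ hY p hp H Λ hH1 _hH2 hΛ hnd n W c r hr halg
  -- an orientation family (the complex points are orientable) and Poincaré duality for it
  let μ : OrientationFamily := fun _ _ h ↦ Classical.choice (Motives.ComplexPoints.isOrientableOver ℂ h)
  have hμ : μ.HasPoincareDuality := OrientationFamily.hasPoincareDuality μ
  haveI : AlgebraicGeometry.Surjective p.left := ⟨hp⟩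
  -- degree bookkeeping for the Gysin maps `p_*` (`a + 2 dim Y = b + 2 dim Q`)
  have hq0 : 2 * m + 2 * nY = 0 + 2 * (nY + m) := by omega
  have hab : 2 * (n + m) + 2 * nY = 2 * n + 2 * (nY + m) := by omega
  have htop : 2 * (nY + m) + 2 * nY = 2 * nY + 2 * (nY + m) := by omega
  -- `p_*(Λᵐ) = t • 1` in `H⁰(Y(ℂ); ℂ) = ℂ · 1`
  obtain ⟨t, ht⟩ := exists_eq_smul_one μ hY (complexGysin μ hQ hY p hq0 (cupPowTwo Λ m))
  -- `t ≠ 0`: `p_*(p^* y ∪ Λᵐ) = y ∪ p_*(Λᵐ) = t • y`, and `p_*` is one-to-one in the top degree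
  have ht0 : t ≠ 0 := by
    rintro rfl
    rw [zero_smul] at ht
    obtain ⟨y, hy⟩ := hnd
    apply hy
    haveI : FiniteDimensional ℂ (complexBetti Q (2 * (nY + m))) :=
      Module.finite_of_finrank_eq_succ (finrank_complexBetti_two_mul_eq_one hQ)
    haveI : FiniteDimensional ℂ (complexBetti Y (2 * nY)) :=
      Module.finite_of_finrank_eq_succ (finrank_complexBetti_two_mul_eq_one hY)
    have hinj : Function.Injective (complexGysin μ hQ hY p htop) :=
      (LinearMap.injective_iff_surjective_of_finrank_eq_finrank
        (by rw [finrank_complexBetti_two_mul_eq_one hQ, finrank_complexBetti_two_mul_eq_one hY])).2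
        (complexGysin_surjective_of_surjective μ hQ hY p htop)
    apply hinj
    rw [map_zero, complexGysin_cup hμ hQ hY p _ htop hq0 (Nat.add_zero _) y (cupPowTwo Λ m), ht,
      map_zero]
  -- push the algebraic class forward along `p_*`
  have h1 := complexGysin_mem_algebraicClasses_of_mem_algebraicClasses μ hQ hY p hab halg
  rw [map_add] at h1
  -- the double sum pushes forward to an algebraic class, so the `W`-term does
  have hT : complexGysin μ hQ hY p hab
      (r • cupProduct (show 2 * n + 2 * m = 2 * (n + m) by omega) (complexBetti.map p (2 * n) W)
        (cupPowTwo Λ m)) ∈ algebraicClasses Y n := by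
    refine (Submodule.add_mem_iff_right _ ?_).1 h1
    rw [map_sum]
    refine Submodule.sum_mem _ fun i _ ↦ ?_
    rw [map_sum]
    refine Submodule.sum_mem _ fun j _ ↦ ?_
    split_ifs with hij
    · rw [map_smul]
      refine Submodule.smul_mem _ _ ?_
      rcases Nat.lt_or_ge j m with hjm | hjm
      · -- `j < m`: `p_*(p^* Hⁱ ∪ Λʲ) = 0` (the fibre degree of `Λʲ` is too small)
        rw [complexGysin_cup_map_eq_zero_of_lt hQ hY p _ hab (by omega) (cupPowTwo H i) (cupPowTwo Λ j)]
        exact zero_mem _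
      · -- `j = m + e`: `p_*(p^* Hⁱ ∪ Λʲ) = Hⁱ ∪ p_*(Λʲ)` with `p_*(Λʲ)` algebraic of codimension `e`
        obtain ⟨e, rfl⟩ := Nat.exists_eq_add_of_le hjm
        have hq : 2 * (m + e) + 2 * nY = 2 * e + 2 * (nY + m) := by omega
        rw [complexGysin_cup hμ hQ hY p _ hab hq (show 2 * i + 2 * e = 2 * n by omega)]
        exact cupPowTwo_cup_mem hH1 i (show i + e = n by omega) _ _
          (complexGysin_mem_algebraicClasses_of_mem_algebraicClasses μ hQ hY p hq (hΛ (m + e)))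
    · rw [map_zero]
      exact zero_mem _
  -- the `W`-term pushes forward to `(r t) • W`
  rw [map_smul, complexGysin_cup hμ hQ hY p _ hab hq0 (Nat.add_zero _) W (cupPowTwo Λ m), ht,
    map_smul, cupProduct_one', smul_smul] at hT
  have h3 := Submodule.smul_mem _ (r * t)⁻¹ hT
  rwa [inv_smul_smul₀ (mul_ne_zero hr ht0)] at h3

end Summit.HodgeConjecture.HodgeConjecture.Theorems.HyperbolicEightfoldsSqrtMinus7.AnchorObjectBS

end
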